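import Summits.NavierStokesRegularity.NavierStokesRegularity.Theorems.FiniteTangentModuliMild.Negative.KolmogorovModes

/-!
# `FiniteTangentModuliMild`, negative side: the Kolmogorov-shear witness of p73226 (bounds, independence)

Support file for `FalseWithoutMild.lean` (crux stmt-NavierStokesRegularity-14049, cdisprove seat):
the Type-I bounds of the decaying Kolmogorov shear (`‖u‖ ≤ 1/√(-t)`, `‖∇u‖ ≤ 1/(-t)`), the growth
bounds of the dressed parasitic modes (`‖v_k‖ ≤ (k+3)²/√(-t)` — x-BOUNDED —,
`|q_k| ≤ (k+3)²(1+‖x‖)/√(-t)³`) and their independence (`∑ c_k a(t)^{k+2} ≡ 0` on `t < 0` forces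
`c = 0`, since `a = (1-t)⁻¹` sweeps `(0,1)`).  Verbatim from p73226 (there `private`).

## References

* G. Koch, N. Nadirashvili, G. Seregin, V. Šverák, Acta Math. 203 (2009), §1 p. 3. [KNSS2009]
-/

noncomputable section

open Set Function Filter Topology WithLp MeasureTheory InnerProductSpace
open scoped Laplacian RealInnerProductSpace ContDiff BigOperators

set_option linter.dupNamespace false

namespace Summit.NavierStokesRegularity.NavierStokesRegularity.Theorems.FiniteTangentModuliMild.Negative

open Literature.Analysis Literature.Analysis.FluidPDE Literature.Analysis.FluidPDE.StrainedShear

/-- Local notation for physical space `ℝ³ = EuclideanSpace ℝ (Fin 3)`. -/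
local notation "ℝ³" => EuclideanSpace ℝ (Fin 3)

namespace KolmogorovCex

/-! ### Growth bounds -/

/-- `‖u(t, x)‖ ≤ 1/√(-t)`. [folklore] -/
theorem norm_drift_le {t : ℝ} (ht : t < 0) (x : ℝ³) : ‖drift t x‖ ≤ 1 / Real.sqrt (-t) := by
  have h1 : ‖drift t x‖ ≤ amp t := by
    show ‖(amp t * Real.sin (x 0)) • eOne‖ ≤ amp t
    rw [norm_smul, norm_eOne, mul_one, Real.norm_eq_abs, abs_mul, abs_of_nonneg (amp_nonneg ht)]
    calc amp t * |Real.sin (x 0)| ≤ amp t * 1 :=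
          mul_le_mul_of_nonneg_left (Real.abs_sin_le_one _) (amp_nonneg ht)
      _ = amp t := mul_one _
  exact h1.trans (amp_le_inv_sqrt ht)

/-- The drift obeys the temporal Type-I bound with `C = 1`. [folklore] -/
theorem hasTypeITimeDecay_drift : HasTypeITimeDecay 1 drift := fun _ ht x =>
  norm_drift_le ht x

/-- `‖∇u(t, x)‖ ≤ 1/(-t)` (operator norm of `a cos(x₀) dx₀ ⊗ e₁` is at most `a`). [folklore] -/
theorem norm_fderiv_drift_le {t : ℝ} (ht : t < 0) (x : ℝ³) : ‖fderiv ℝ (drift t) x‖ ≤ 1 / (-t) := by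
  refine (ContinuousLinearMap.opNorm_le_bound _ (amp_nonneg ht) fun h => ?_).trans (amp_le_inv ht)
  rw [fderiv_drift_apply, norm_smul, norm_eOne, mul_one, Real.norm_eq_abs, abs_mul, abs_mul,
    abs_of_nonneg (amp_nonneg ht)]
  have h0 : |h 0| ≤ ‖h‖ := by
    have := PiLp.norm_apply_le h 0
    simpa [Real.norm_eq_abs] using this
  calc amp t * |Real.cos (x 0)| * |h 0| ≤ amp t * 1 * ‖h‖ :=
        mul_le_mul (mul_le_mul_of_nonneg_left (Real.abs_cos_le_one _) (amp_nonneg ht)) h0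
          (abs_nonneg _) (by have := amp_nonneg ht; positivity)
    _ = amp t * ‖h‖ := by ring

/-- `‖v_k(t, x)‖ ≤ (k+3)²/√(-t)`. [folklore] -/
theorem norm_mode_le {t : ℝ} (ht : t < 0) (k : ℕ) (x : ℝ³) :
    ‖mode k t x‖ ≤ ((k : ℝ) + 3) ^ 2 / Real.sqrt (-t) := by
  have ha := amp_nonneg ht
  have ha1 := amp_le_one ht
  have hk : (0 : ℝ) ≤ k := Nat.cast_nonneg k
  have h1 : ‖mode k t x‖ ≤ ((k : ℝ) + 4) * amp t := by
    show ‖(amp t ^ (k + 2) * Real.cos (x 0)) • eOne + bee k t • eZero‖ ≤ _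
    refine (norm_add_le _ _).trans ?_
    rw [norm_smul, norm_smul, norm_eOne, norm_eZero, mul_one, mul_one, Real.norm_eq_abs,
      Real.norm_eq_abs, abs_mul]
    have hp2 : amp t ^ (k + 2) ≤ amp t := amp_pow_succ_le ht _
    have hp1 : amp t ^ (k + 1) ≤ amp t := amp_pow_succ_le ht _
    have hc : |Real.cos (x 0)| ≤ 1 := Real.abs_cos_le_one _
    have hbee : |bee k t| ≤ ((k : ℝ) + 2) * amp t + amp t := by
      simp only [bee, abs_neg]
      rw [abs_of_nonneg (by positivity)]
      nlinarith
    have hfirst : |amp t ^ (k + 2)| * |Real.cos (x 0)| ≤ amp t := by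
      rw [abs_of_nonneg (by positivity)]
      nlinarith [abs_nonneg (Real.cos (x 0)), pow_nonneg ha (k + 2)]
    nlinarith
  have h2 : ((k : ℝ) + 4) * amp t ≤ ((k : ℝ) + 3) ^ 2 * amp t :=
    mul_le_mul_of_nonneg_right (by nlinarith) ha
  calc ‖mode k t x‖ ≤ ((k : ℝ) + 3) ^ 2 * amp t := h1.trans h2
    _ ≤ ((k : ℝ) + 3) ^ 2 * (1 / Real.sqrt (-t)) :=
        mul_le_mul_of_nonneg_left (amp_le_inv_sqrt ht) (by positivity)
    _ = ((k : ℝ) + 3) ^ 2 / Real.sqrt (-t) := by ring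

/-- `Q_k ≥ 0` on `t < 0`. [folklore] -/
theorem cue_nonneg {t : ℝ} (ht : t < 0) (k : ℕ) : 0 ≤ cue k t := by
  have ha := amp_nonneg ht
  simp only [cue]
  positivity

/-- `Q_k ≤ (k+3)²/√(-t)³` on `t < 0`. [folklore] -/
theorem cue_le {t : ℝ} (ht : t < 0) (k : ℕ) : cue k t ≤ ((k : ℝ) + 3) ^ 2 / Real.sqrt (-t) ^ 3 := by
  have ha := amp_nonneg ht
  have hk : (0 : ℝ) ≤ k := Nat.cast_nonneg k
  have h3 : amp t ^ (k + 3) ≤ amp t ^ 2 := amp_pow_le_sq ht (k + 1)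
  have h2 : amp t ^ (k + 2) ≤ amp t ^ 2 := amp_pow_le_sq ht k
  have h1 : cue k t ≤ ((k : ℝ) + 3) ^ 2 * amp t ^ 2 := by
    simp only [cue]
    nlinarith
  calc cue k t ≤ ((k : ℝ) + 3) ^ 2 * amp t ^ 2 := h1
    _ ≤ ((k : ℝ) + 3) ^ 2 * (1 / Real.sqrt (-t) ^ 3) :=
        mul_le_mul_of_nonneg_left (amp_sq_le ht) (by positivity)
    _ = ((k : ℝ) + 3) ^ 2 / Real.sqrt (-t) ^ 3 := by ring

/-- `|q_k(t, x)| ≤ (k+3)²(1 + ‖x‖)/√(-t)³`. [folklore] -/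
theorem abs_modePressure_le {t : ℝ} (ht : t < 0) (k : ℕ) (x : ℝ³) :
    |modePressure k t x| ≤ ((k : ℝ) + 3) ^ 2 * (1 + ‖x‖) / Real.sqrt (-t) ^ 3 := by
  have hs : 0 < Real.sqrt (-t) := Real.sqrt_pos.2 (by linarith)
  have h1 : |modePressure k t x| ≤ cue k t * ‖x‖ := by
    refine (abs_real_inner_le_norm _ _).trans (le_of_eq ?_)
    rw [norm_smul, norm_eZero, mul_one, Real.norm_eq_abs, abs_of_nonneg (cue_nonneg ht k)]
  have h2 : cue k t * ‖x‖ ≤ ((k : ℝ) + 3) ^ 2 / Real.sqrt (-t) ^ 3 * (1 + ‖x‖) :=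
    mul_le_mul (cue_le ht k) (by linarith [norm_nonneg x]) (norm_nonneg x) (by positivity)
  calc |modePressure k t x| ≤ ((k : ℝ) + 3) ^ 2 / Real.sqrt (-t) ^ 3 * (1 + ‖x‖) := h1.trans h2
    _ = ((k : ℝ) + 3) ^ 2 * (1 + ‖x‖) / Real.sqrt (-t) ^ 3 := by ring

/-! ### Independence modulo slice constants -/

/-- The `e₁`-component of a combination of modes. [folklore] -/
theorem sum_smul_mode_apply_one {ι : Type*} (s : Finset ι) (c : ι → ℝ) (k : ι → ℕ) (t : ℝ)
    (x : ℝ³) : (∑ i ∈ s, c i • mode (k i) t x) 1 = ∑ i ∈ s, c i * (amp t ^ (k i + 2) * Real.cos (x 0)) := by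
  induction s using Finset.cons_induction with
  | empty => simp
  | cons a s ha ih =>
    rw [Finset.sum_cons, Finset.sum_cons, PiLp.add_apply, PiLp.smul_apply, ih, mode_apply_one,
      smul_eq_mul]

/-- If a combination of the modes is spatially constant on the slice `t`, then
`∑ cᵢ a(t)^{kᵢ+2} = 0`. -/
theorem sum_eq_zero_of_slice_constant {N : ℕ} (c : Fin (N + 1) → ℝ) {t : ℝ}
    (h : ∃ b : ℝ³, ∀ x, ∑ i, c i • mode (i : ℕ) t x = b) :
    ∑ i, c i * amp t ^ ((i : ℕ) + 2) = 0 := by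
  obtain ⟨b, hb⟩ := h
  have h0 := congrArg (fun v : ℝ³ => v 1) (hb 0)
  have hπ := congrArg (fun v : ℝ³ => v 1) (hb (EuclideanSpace.single 0 Real.pi))
  simp only at h0 hπ
  rw [sum_smul_mode_apply_one] at h0 hπ
  simp only [PiLp.zero_apply, Real.cos_zero, mul_one] at h0
  simp only [PiLp.single_apply, if_true, Real.cos_pi, mul_neg, mul_one, Finset.sum_neg_distrib]
    at hπ
  linarith

/-- `amp` maps `(-∞, 0)` onto `(0, 1)`: every `y ∈ (0, 1)` is `a(t)` for `t = 1 - y⁻¹ < 0`. -/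
theorem amp_one_sub_inv (y : ℝ) : amp (1 - y⁻¹) = y := by
  simp [amp]

/-- `1 - y⁻¹ < 0` for `y ∈ (0, 1)`. [folklore] -/
theorem one_sub_inv_neg {y : ℝ} (hy0 : 0 < y) (hy1 : y < 1) : 1 - y⁻¹ < 0 := by
  have : 1 < y⁻¹ := (one_lt_inv₀ hy0).2 hy1
  linarith

/-- Distinct powers are linearly independent on `(0, 1)`. -/
theorem coeff_eq_zero_of_sum_pow_eq_zero {N : ℕ} (c : Fin (N + 1) → ℝ)
    (h : ∀ y ∈ Ioo (0 : ℝ) 1, ∑ i, c i * y ^ ((i : ℕ) + 2) = 0) : c = 0 := by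
  classical
  set P : Polynomial ℝ := ∑ i, Polynomial.C (c i) * Polynomial.X ^ ((i : ℕ) + 2) with hP
  have heval : ∀ y, P.eval y = ∑ i, c i * y ^ ((i : ℕ) + 2) := fun y => by
    simp [hP, Polynomial.eval_finsetSum]
  have hroots : Set.Infinite {y | P.IsRoot y} := by
    refine (Ioo_infinite (zero_lt_one' ℝ)).mono fun y hy => ?_
    simp only [Set.mem_setOf_eq, Polynomial.IsRoot.def, heval]
    exact h y hy
  have hP0 : P = 0 := Polynomial.eq_zero_of_infinite_isRoot P hroots
  funext j
  have hcoeff : P.coeff ((j : ℕ) + 2) = c j := by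
    simp only [hP, Polynomial.finsetSum_coeff, Polynomial.coeff_C_mul_X_pow]
    rw [Finset.sum_eq_single j]
    · simp
    · intro i _ hij
      rw [if_neg]
      intro hh
      exact hij (Fin.ext (by omega))
    · intro hj
      exact absurd (Finset.mem_univ j) hj
  rw [← hcoeff, hP0, Polynomial.coeff_zero, Pi.zero_apply]

end KolmogorovCex

end Summit.NavierStokesRegularity.NavierStokesRegularity.Theorems.FiniteTangentModuliMild.Negative

end
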